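import Literature.Probability.Moments.HoeffdingMeanBounds
import Summits.Ventures.LatticeQCDFlow.Exactness.FlowAcceptanceModelLipschitz
import HarnessLib

/-!
# The parity leg from finitely many draws: Hoeffding certificates for the exceptional-set masses,
# and the acceptance column of an A-vs-B table with a confidence level

HONEST FRAMING: exact (Metropolis-corrected) sampling algorithms for lattice gauge theory;
figures of merit are autocorrelation/cost numbers at stated couplings and volumes; no
continuum-physics claim.

Venture `LatticeQCDFlow` (cell pub-lqcd), topic `Scoring`; FANOUT row 4 (`s0-u1-b`, rung S0-B:
two independent codes A, B for the 2D U(1) flow sampler, compared column by column).  The row's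
density-parity files (`Scaling/DensityParityCertificates`, `Scaling/DensityParityTargetSide`,
`Exactness/FlowAcceptanceModelLipschitz`, `Exactness/FlowESSTargetSideParity`,
`Exactness/IMHTauIntParityDefect*`) are DETERMINISTIC: a parity `|log q − log q'| ≤ δ` that fails
on an exceptional set `E` pins each leaderboard column of the two codes up to explicit masses of
`E` — the MODEL masses `q(E)`, `q'(E)` (acceptance), the TARGET-WEIGHTED masses `∫_E p²/q`
(effective sample size), the TARGET mass `π(E)` (`τ_int`).  Their docstrings list as NOT CLAIMED
'any statistical statement (confidence bounds for these masses from finitely many draws)'.  This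
file supplies that leg in the one sampling frame a flow provides for free — INDEPENDENT draws from
the model — using the tree's Hoeffding inequality
(`Literature.Probability.Moments.measureReal_le_sum_le_exp_of_integral_le`, from Mathlib's
`hasSubgaussianMGF_of_mem_Icc` / `measure_sum_ge_le_of_iIndepFun`).  NEW WORK of the cell
(elementary); the one cited fact is Hoeffding 1963 Thm. 2, already in the tree; no definition is
introduced.

## Setting

`(Ω, P)` a probability space carrying the draws; `(X, μ)` the configuration space with its
reference measure; a model density `q ≥ 0` (measurable) w.r.t. `μ`; draws `x i : Ω → X`, `i ∈ ι`,
INDEPENDENT (`iIndepFun x P`) and each distributed as the model,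
`P ∘ (x i)⁻¹ = μ.withDensity q` (`hlaw`); a measurable score `F : X → ℝ` with values in `[0, M]`;
`s` a finite set of indices, `n = #s`.

## What is proved

* §1 `measureReal_sum_add_le_card_mul_le_exp` — LOWER-tail Hoeffding with a common LOWER bound on
  the means: independent real `Yᵢ ∈ [0, M]` a.s. with `m ≤ E Yᵢ` ⇒ for `t ≥ 0`,
  `P(Σ_{i∈s} Yᵢ + n t ≤ n m) ≤ exp(−2 n t²/M²)` — "the unknown mean exceeds the empirical mean
  by `t`" is exponentially unlikely; the direction that gives UPPER confidence bounds on masses.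
* §2 `integral_comp_eq_integral_mul_of_map_eq` — the law dictionary: `P ∘ x⁻¹ = μ.withDensity q`
  ⇒ `E F(x) = ∫ F q dμ` for measurable `F`.
* §3 **`measureReal_sum_comp_add_le_exp_of_model_draws`** — model draws, `F ∈ [0, M]`:
  `P(Σ_{i∈s} F(xᵢ) + n t ≤ n ∫ F q dμ) ≤ exp(−2 n t²/M²)`; its three instances
  **`modelMass_le_freq_confidence`** (`F = 1_E`: `P(N_E + n t ≤ n·q(E)) ≤ e^{−2nt²}`, `N_E` the
  failure count), **`targetMass_le_weightedFreq_confidence`** (`F = 1_E·w/(Z q)` under a weight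
  ceiling `w ≤ C q`, `Z > 0`: `P(Σ 1_E(xᵢ) w(xᵢ)/(Z q(xᵢ)) + n t ≤ n·∫_E w/Z) ≤ e^{−2nt²Z²/C²}`),
  **`sqWeightMass_le_weightedFreq_confidence`** (`F = 1_E·(p/q)²` under `p ≤ W q`:
  `P(Σ 1_E(xᵢ)(p/q)²(xᵢ) + n t ≤ n·∫_E p²/q) ≤ e^{−2nt²/W⁴}`).
* §4 **`acceptance_parityLeg_confidence`** — THE ACCEPTANCE COLUMN WITH A CONFIDENCE LEVEL:
  normalised target `p`, positive models `q, q'`, parity `δ ≥ 0` off a measurable `E`; a leg of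
  `n` independent draws from `q` with failure count `N`, a leg of `n'` independent draws from `q'`
  with failure count `N'` (no independence BETWEEN the legs is needed); `t, t' ≥ 0`.  Then
  `P( |acc(p,q) − acc(p,q')| > (e^{δ} − 1) + (N/n + t) + (N'/n' + t') ) ≤ e^{−2nt²} + e^{−2n't'²}`
  (`Exactness.MeanAcceptLipschitz.abs_meanAccept_sub_le_of_logParityOff` + §3 + a union bound);
  `acceptance_parityLeg_confidence_level` — the same at prescribed levels `η, η'` with the
  Hoeffding radii `t = √(log(1/η)/(2n))`, `t' = √(log(1/η')/(2n'))`: probability `≤ η + η'`.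

Reading for row 4 (value-free; no number of ours, no sealed value): the parity leg is operational.
Run each code's sampler for `n` proposals, evaluate the other code's log-density on them, count the
configurations where the two disagree by more than `δ`; the two failure frequencies plus Hoeffding
radii bound the model masses of the exceptional set from above with a stated confidence, and with
them the acceptance-column discrepancy the deterministic law allows.  The target mass and the
target-weighted mass that the `τ_int` and ESS columns need are means of BOUNDED scores under the
same model draws once a weight ceiling is certified (§3), so the same leg serves all three columns
(their composed certificates are the sequel file).  NOT CLAIMED: anything about draws from the
accepted CHAIN (Markov-dependent; that is `Scoring/ChainHoeffding`'s frame, not used here);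
estimating `δ` or the weight ceiling themselves; Bernstein/empirical-variance radii; optimality of
Hoeffding's constant; any number re-scored.
-/

noncomputable section

namespace Summit.Ventures.LatticeQCDFlow.Scoring.ParityLeg

open MeasureTheory ProbabilityTheory Finset Real Set

variable {Ω : Type*} [MeasurableSpace Ω] {P : Measure Ω} [IsProbabilityMeasure P] {ι : Type*}
variable {X : Type*} [MeasurableSpace X] {μ : Measure X}

/-! ## §1 Lower-tail Hoeffding with a common lower bound on the means -/

/-- **Lower-tail Hoeffding.**  Independent real random variables `Yᵢ` with values a.s. in `[0, M]`
and a common LOWER bound `m ≤ E Yᵢ` on their means satisfy, for every finite index set `s`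
(`n = #s`) and every `t ≥ 0`: `P(Σ_{i∈s} Yᵢ + n t ≤ n m) ≤ exp(−2 n t²/M²)`
(the tree's upper-tail form applied to `−Yᵢ ∈ [−M, 0]`). [cite: Hoeffding1963, Thm. 2] -/
theorem measureReal_sum_add_le_card_mul_le_exp {Y : ι → Ω → ℝ} (hind : iIndepFun Y P)
    (hmeas : ∀ i, AEMeasurable (Y i) P) {M : ℝ} (hY : ∀ i, ∀ᵐ ω ∂P, Y i ω ∈ Icc 0 M)
    {m : ℝ} (hm : ∀ i, m ≤ ∫ ω, Y i ω ∂P) {t : ℝ} (ht : 0 ≤ t) (s : Finset ι) :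
    P.real {ω | ∑ i ∈ s, Y i ω + s.card * t ≤ s.card * m}
      ≤ Real.exp (-(2 * s.card * t ^ 2 / M ^ 2)) := by
  have hind' : iIndepFun (fun i ω => -Y i ω) P := hind.comp (fun _ y => -y) fun _ => measurable_neg
  have hmeas' : ∀ i, AEMeasurable (fun ω => -Y i ω) P := fun i => (hmeas i).neg
  have hY' : ∀ i, ∀ᵐ ω ∂P, -Y i ω ∈ Icc (-M) 0 := fun i => by
    filter_upwards [hY i] with ω hω
    exact ⟨neg_le_neg hω.2, neg_nonpos.2 hω.1⟩
  have hm' : ∀ i, ∫ ω, -Y i ω ∂P ≤ -m := fun i => by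
    rw [integral_neg]; exact neg_le_neg (hm i)
  have h := Literature.Probability.Moments.measureReal_le_sum_le_exp_of_integral_le hind' hmeas'
    hY' hm' ht s
  rw [sub_neg_eq_add, zero_add] at h
  refine (measureReal_mono fun ω hω => ?_).trans h
  simp only [mem_setOf_eq, sum_neg_distrib] at hω ⊢
  linarith

/-! ## §2 The law dictionary: model draws have `q dμ`-means -/

omit [IsProbabilityMeasure P] in
/-- **Law dictionary.**  If `x : Ω → X` is measurable with law `P ∘ x⁻¹ = μ.withDensity q`
(`q ≥ 0` measurable, as an `ℝ≥0∞`-density through `ENNReal.ofReal`), then for every measurable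
real `F`: `∫ F(x ω) dP(ω) = ∫ F(y) q(y) dμ(y)` (both sides `0` together when not integrable).
[folklore] -/
theorem integral_comp_eq_integral_mul_of_map_eq {x : Ω → X} (hxm : Measurable x) {q : X → ℝ}
    (hq0 : ∀ y, 0 ≤ q y) (hqm : Measurable q)
    (hlaw : Measure.map x P = μ.withDensity fun y => ENNReal.ofReal (q y)) {F : X → ℝ}
    (hFm : Measurable F) : ∫ ω, F (x ω) ∂P = ∫ y, F y * q y ∂μ := by
  rw [← integral_map hxm.aemeasurable hFm.aestronglyMeasurable, hlaw,
    integral_withDensity_eq_integral_toReal_smul hqm.ennreal_ofReal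
      (Filter.Eventually.of_forall fun _ => ENNReal.ofReal_lt_top)]
  refine integral_congr_ae (Filter.Eventually.of_forall fun y => ?_)
  simp only [ENNReal.toReal_ofReal (hq0 y), smul_eq_mul, mul_comm]

/-! ## §3 Means of bounded scores under the model, from independent model draws -/

/-- **HOEFFDING FOR MODEL DRAWS.**  Independent draws `xᵢ` from the model `q` (`hlaw`), a measurable
score `F` with values in `[0, M]`; then for every finite `s` (`n = #s`) and `t ≥ 0`:
`P(Σ_{i∈s} F(xᵢ) + n t ≤ n·∫ F q dμ) ≤ exp(−2 n t²/M²)` — the model mean of `F` exceeds its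
empirical mean by `t` or more only with that probability. -/
theorem measureReal_sum_comp_add_le_exp_of_model_draws {x : ι → Ω → X} (hind : iIndepFun x P)
    (hxm : ∀ i, Measurable (x i)) {q : X → ℝ} (hq0 : ∀ y, 0 ≤ q y) (hqm : Measurable q)
    (hlaw : ∀ i, Measure.map (x i) P = μ.withDensity fun y => ENNReal.ofReal (q y)) {F : X → ℝ}
    (hFm : Measurable F) {M : ℝ} (hF : ∀ y, F y ∈ Icc 0 M) {t : ℝ} (ht : 0 ≤ t) (s : Finset ι) :
    P.real {ω | ∑ i ∈ s, F (x i ω) + s.card * t ≤ s.card * ∫ y, F y * q y ∂μ}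
      ≤ Real.exp (-(2 * s.card * t ^ 2 / M ^ 2)) := by
  have hind' : iIndepFun (fun i ω => F (x i ω)) P := hind.comp (fun _ => F) fun _ => hFm
  refine measureReal_sum_add_le_card_mul_le_exp hind' (fun i => (hFm.comp (hxm i)).aemeasurable)
    (fun i => Filter.Eventually.of_forall fun ω => hF (x i ω)) (fun i => le_of_eq ?_) ht s
  exact (integral_comp_eq_integral_mul_of_map_eq (hxm i) hq0 hqm (hlaw i) hFm).symm

/-- **The MODEL mass of the exceptional set from the failure count.**  Independent draws `xᵢ` from
`q`, a measurable `E`, `N_E = #{i ∈ s : xᵢ ∈ E}` (written as `Σ 1_E(xᵢ)`); for `t ≥ 0`: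
`P(N_E + n t ≤ n·∫_E q dμ) ≤ exp(−2 n t²)` — i.e. `q(E) < N_E/n + t` with confidence
`1 − e^{−2nt²}`. -/
theorem modelMass_le_freq_confidence {x : ι → Ω → X} (hind : iIndepFun x P)
    (hxm : ∀ i, Measurable (x i)) {q : X → ℝ} (hq0 : ∀ y, 0 ≤ q y) (hqm : Measurable q)
    (hlaw : ∀ i, Measure.map (x i) P = μ.withDensity fun y => ENNReal.ofReal (q y)) {E : Set X}
    (hE : MeasurableSet E) {t : ℝ} (ht : 0 ≤ t) (s : Finset ι) :
    P.real {ω | ∑ i ∈ s, E.indicator (fun _ => (1 : ℝ)) (x i ω) + s.card * t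
        ≤ s.card * ∫ y in E, q y ∂μ}
      ≤ Real.exp (-(2 * s.card * t ^ 2)) := by
  have hF : ∀ y, E.indicator (fun _ => (1 : ℝ)) y ∈ Icc (0 : ℝ) 1 := fun y => by
    by_cases hy : y ∈ E
    · rw [indicator_of_mem hy]; exact ⟨zero_le_one, le_rfl⟩
    · rw [indicator_of_notMem hy]; exact ⟨le_rfl, zero_le_one⟩
  have h := measureReal_sum_comp_add_le_exp_of_model_draws hind hxm hq0 hqm hlaw
    (measurable_const.indicator hE) hF ht s
  have e : ∫ y, E.indicator (fun _ => (1 : ℝ)) y * q y ∂μ = ∫ y in E, q y ∂μ := by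
    rw [← integral_indicator hE]
    refine integral_congr_ae (Filter.Eventually.of_forall fun y => ?_)
    by_cases hy : y ∈ E
    · simp only [indicator_of_mem hy, one_mul]
    · simp only [indicator_of_notMem hy, zero_mul]
  rw [e, one_pow, div_one] at h
  exact h

/-- **The TARGET mass of the exceptional set from importance-weighted failures.**  Independent
draws `xᵢ` from `q > 0`; a target weight `w ≥ 0` (measurable) with `Z > 0` and a weight ceiling
`w ≤ C q` (so the normalised importance weight `w/(Z q)` lies in `[0, C/Z]`); a measurable `E`;
`t ≥ 0`.  Then `P(Σ_{i∈s} 1_E(xᵢ)·w(xᵢ)/(Z q(xᵢ)) + n t ≤ n·(∫_E w dμ)/Z) ≤ exp(−2 n t² Z²/C²)` —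
`π(E) = ∫_E w/Z < π̂_E + t` with confidence `1 − e^{−2nt²/W²}`, `W = C/Z`. -/
theorem targetMass_le_weightedFreq_confidence {x : ι → Ω → X} (hind : iIndepFun x P)
    (hxm : ∀ i, Measurable (x i)) {q : X → ℝ} (hq0 : ∀ y, 0 < q y) (hqm : Measurable q)
    (hlaw : ∀ i, Measure.map (x i) P = μ.withDensity fun y => ENNReal.ofReal (q y)) {w : X → ℝ}
    (hw0 : ∀ y, 0 ≤ w y) (hwm : Measurable w) {Z C : ℝ} (hZ : 0 < Z) (hC : ∀ y, w y ≤ C * q y)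
    {E : Set X} (hE : MeasurableSet E) {t : ℝ} (ht : 0 ≤ t) (s : Finset ι) :
    P.real {ω | ∑ i ∈ s, E.indicator (fun y => w y / (Z * q y)) (x i ω) + s.card * t
        ≤ s.card * ((∫ y in E, w y ∂μ) / Z)}
      ≤ Real.exp (-(2 * s.card * t ^ 2 * Z ^ 2 / C ^ 2)) := by
  have hF : ∀ y, E.indicator (fun y => w y / (Z * q y)) y ∈ Icc (0 : ℝ) (C / Z) := fun y => by
    have hCZ : 0 ≤ C / Z := by
      have := (hw0 y).trans (hC y)
      exact div_nonneg (nonneg_of_mul_nonneg_left this (hq0 y)) hZ.le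
    by_cases hy : y ∈ E
    · rw [indicator_of_mem hy]
      refine ⟨div_nonneg (hw0 y) (mul_pos hZ (hq0 y)).le, ?_⟩
      rw [div_le_div_iff₀ (mul_pos hZ (hq0 y)) hZ]
      calc w y * Z ≤ C * q y * Z := mul_le_mul_of_nonneg_right (hC y) hZ.le
        _ = C * (Z * q y) := by ring
    · rw [indicator_of_notMem hy]; exact ⟨le_rfl, hCZ⟩
  have hFm : Measurable (E.indicator fun y => w y / (Z * q y)) :=
    (hwm.div (measurable_const.mul hqm)).indicator hE
  have h := measureReal_sum_comp_add_le_exp_of_model_draws hind hxm (fun y => (hq0 y).le) hqm hlaw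
    (F := E.indicator fun y => w y / (Z * q y)) hFm hF ht s
  have e : ∫ y, E.indicator (fun y => w y / (Z * q y)) y * q y ∂μ = (∫ y in E, w y ∂μ) / Z := by
    rw [← integral_indicator hE, ← integral_div]
    refine integral_congr_ae (Filter.Eventually.of_forall fun y => ?_)
    by_cases hy : y ∈ E
    · simp only [indicator_of_mem hy]
      field_simp [(hq0 y).ne', hZ.ne']
    · simp only [indicator_of_notMem hy, zero_mul, zero_div]
  rw [e] at h
  refine h.trans (le_of_eq ?_)
  congr 1
  field_simp

/-- **The TARGET-WEIGHTED mass of the exceptional set (ESS column) from squared-weight failures.**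
Independent draws `xᵢ` from `q > 0`; a normalised target density `p ≥ 0` (measurable) with a
weight ceiling `p ≤ W q`; a measurable `E`; `t ≥ 0`.  Then
`P(Σ_{i∈s} 1_E(xᵢ)·(p(xᵢ)/q(xᵢ))² + n t ≤ n·∫_E p²/q dμ) ≤ exp(−2 n t²/W⁴)` — the mass
`m_E = ∫_E p²/q` of `Exactness/FlowESSTargetSideParity` is a model mean of the bounded score
`1_E (p/q)² ∈ [0, W²]`. -/
theorem sqWeightMass_le_weightedFreq_confidence {x : ι → Ω → X} (hind : iIndepFun x P)
    (hxm : ∀ i, Measurable (x i)) {q : X → ℝ} (hq0 : ∀ y, 0 < q y) (hqm : Measurable q)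
    (hlaw : ∀ i, Measure.map (x i) P = μ.withDensity fun y => ENNReal.ofReal (q y)) {p : X → ℝ}
    (hp0 : ∀ y, 0 ≤ p y) (hpm : Measurable p) {W : ℝ} (hW : ∀ y, p y ≤ W * q y)
    {E : Set X} (hE : MeasurableSet E) {t : ℝ} (ht : 0 ≤ t) (s : Finset ι) :
    P.real {ω | ∑ i ∈ s, E.indicator (fun y => (p y / q y) ^ 2) (x i ω) + s.card * t
        ≤ s.card * ∫ y in E, p y ^ 2 / q y ∂μ}
      ≤ Real.exp (-(2 * s.card * t ^ 2 / W ^ 4)) := by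
  have hF : ∀ y, E.indicator (fun y => (p y / q y) ^ 2) y ∈ Icc (0 : ℝ) (W ^ 2) := fun y => by
    have hr : p y / q y ≤ W := by rw [div_le_iff₀ (hq0 y)]; exact hW y
    have hr0 : 0 ≤ p y / q y := div_nonneg (hp0 y) (hq0 y).le
    by_cases hy : y ∈ E
    · rw [indicator_of_mem hy]
      exact ⟨sq_nonneg _, pow_le_pow_left₀ hr0 hr 2⟩
    · rw [indicator_of_notMem hy]; exact ⟨le_rfl, sq_nonneg _⟩
  have hFm : Measurable (E.indicator fun y => (p y / q y) ^ 2) :=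
    ((hpm.div hqm).pow_const 2).indicator hE
  have h := measureReal_sum_comp_add_le_exp_of_model_draws hind hxm (fun y => (hq0 y).le) hqm hlaw
    (F := E.indicator fun y => (p y / q y) ^ 2) hFm hF ht s
  have e : ∫ y, E.indicator (fun y => (p y / q y) ^ 2) y * q y ∂μ = ∫ y in E, p y ^ 2 / q y ∂μ := by
    rw [← integral_indicator hE]
    refine integral_congr_ae (Filter.Eventually.of_forall fun y => ?_)
    by_cases hy : y ∈ E
    · simp only [indicator_of_mem hy]
      field_simp [(hq0 y).ne']
    · simp only [indicator_of_notMem hy, zero_mul]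
  rw [e] at h
  refine h.trans (le_of_eq ?_)
  congr 1
  rw [show (W ^ 2) ^ 2 = W ^ 4 by ring]

/-! ## §4 The acceptance column with a confidence level -/

/-- **THE ACCEPTANCE COLUMN OF AN A-vs-B TABLE, CERTIFIED FROM TWO PARITY LEGS.**  `(X, μ)`
s-finite; `p ≥ 0` a normalised target density; `q, q' > 0` two normalised model densities (the
two codes); parity `|log q − log q'| ≤ δ` off a measurable `E`, `δ ≥ 0`; `acc(p, q) =
∫∫ min(p(x)q(y), p(y)q(x))` the equilibrium acceptance of the flow sampler with model `q`.  LEGS: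
independent draws `xᵢ` (`i ∈ s`, `n = #s ≥ 1`) from `q` with failure count `N = Σ 1_E(xᵢ)`, and
independent draws `x'ⱼ` (`j ∈ s'`, `n' = #s' ≥ 1`) from `q'` with failure count `N'` — all on one
probability space, nothing assumed between the two legs.  Then for `t, t' ≥ 0`:
`P( (e^{δ} − 1) + (N/n + t) + (N'/n' + t') < |acc(p,q) − acc(p,q')| ) ≤ e^{−2nt²} + e^{−2n't'²}`. -/
theorem acceptance_parityLeg_confidence [SFinite μ] {p q q' : X → ℝ} (hp0 : ∀ y, 0 ≤ p y)
    (hpm : Measurable p) (hpi : Integrable p μ) (hp1 : ∫ y, p y ∂μ = 1) (hq0 : ∀ y, 0 < q y)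
    (hqm : Measurable q) (hqi : Integrable q μ) (hq1 : ∫ y, q y ∂μ = 1) (hq0' : ∀ y, 0 < q' y)
    (hqm' : Measurable q') (hqi' : Integrable q' μ) (hq1' : ∫ y, q' y ∂μ = 1) {E : Set X}
    (hE : MeasurableSet E) {δ : ℝ} (hδ : 0 ≤ δ)
    (hlog : ∀ y, y ∉ E → |Real.log (q y) - Real.log (q' y)| ≤ δ)
    {x : ι → Ω → X} (hind : iIndepFun x P) (hxm : ∀ i, Measurable (x i))
    (hlaw : ∀ i, Measure.map (x i) P = μ.withDensity fun y => ENNReal.ofReal (q y))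
    {ι' : Type*} {x' : ι' → Ω → X} (hind' : iIndepFun x' P) (hxm' : ∀ j, Measurable (x' j))
    (hlaw' : ∀ j, Measure.map (x' j) P = μ.withDensity fun y => ENNReal.ofReal (q' y))
    (s : Finset ι) (s' : Finset ι') (hs : 0 < s.card) (hs' : 0 < s'.card) {t t' : ℝ}
    (ht : 0 ≤ t) (ht' : 0 ≤ t') :
    P.real {ω | (Real.exp δ - 1)
          + ((∑ i ∈ s, E.indicator (fun _ => (1 : ℝ)) (x i ω)) / s.card + t)
          + ((∑ j ∈ s', E.indicator (fun _ => (1 : ℝ)) (x' j ω)) / s'.card + t')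
        < |(∫ a, ∫ b, min (p a * q b) (p b * q a) ∂μ ∂μ)
            - ∫ a, ∫ b, min (p a * q' b) (p b * q' a) ∂μ ∂μ|}
      ≤ Real.exp (-(2 * s.card * t ^ 2)) + Real.exp (-(2 * s'.card * t' ^ 2)) := by
  have hlaw_acc := Exactness.MeanAcceptLipschitz.abs_meanAccept_sub_le_of_logParityOff hp0 hpm hpi
    hp1 hq0 hqm hqi hq1 hq0' hqm' hqi' hq1' hE hlog
  have hA := modelMass_le_freq_confidence hind hxm (fun y => (hq0 y).le) hqm hlaw hE ht s
  have hA' := modelMass_le_freq_confidence hind' hxm' (fun y => (hq0' y).le) hqm' hlaw' hE ht' s'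
  -- `∫_{Eᶜ} q ≤ 1`, so the parity term is at most `e^δ − 1`
  have hEc : ∫ y in Eᶜ, q y ∂μ ≤ 1 := by
    rw [← hq1]
    exact setIntegral_le_integral hqi (Filter.Eventually.of_forall fun y => (hq0 y).le)
  have hexp : 0 ≤ Real.exp δ - 1 := by linarith [Real.add_one_le_exp δ]
  have hn : (0 : ℝ) < s.card := by exact_mod_cast hs
  have hn' : (0 : ℝ) < s'.card := by exact_mod_cast hs'
  set N : Ω → ℝ := fun ω => ∑ i ∈ s, E.indicator (fun _ => (1 : ℝ)) (x i ω) with hN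
  set N' : Ω → ℝ := fun ω => ∑ j ∈ s', E.indicator (fun _ => (1 : ℝ)) (x' j ω) with hN'
  -- the bad event forces one of the two legs to under-cover its model mass
  have hsub : {ω | (Real.exp δ - 1) + (N ω / s.card + t) + (N' ω / s'.card + t')
        < |(∫ a, ∫ b, min (p a * q b) (p b * q a) ∂μ ∂μ)
            - ∫ a, ∫ b, min (p a * q' b) (p b * q' a) ∂μ ∂μ|}
      ⊆ {ω | N ω + s.card * t ≤ s.card * ∫ y in E, q y ∂μ}
        ∪ {ω | N' ω + s'.card * t' ≤ s'.card * ∫ y in E, q' y ∂μ} := by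
    intro ω hω
    simp only [mem_setOf_eq, mem_union] at hω ⊢
    by_contra hcon
    obtain ⟨h1, h2⟩ := not_or.mp hcon
    have h1 := not_le.mp h1
    have h2 := not_le.mp h2
    have h1' : ∫ y in E, q y ∂μ < N ω / s.card + t := by
      rw [div_add' _ _ _ hn.ne', lt_div_iff₀ hn]; linarith
    have h2' : ∫ y in E, q' y ∂μ < N' ω / s'.card + t' := by
      rw [div_add' _ _ _ hn'.ne', lt_div_iff₀ hn']; linarith
    have h3 : (Real.exp δ - 1) * ∫ y in Eᶜ, q y ∂μ ≤ Real.exp δ - 1 := by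
      have := mul_le_mul_of_nonneg_left hEc hexp
      linarith
    linarith
  calc P.real {ω | (Real.exp δ - 1) + (N ω / s.card + t) + (N' ω / s'.card + t')
          < |(∫ a, ∫ b, min (p a * q b) (p b * q a) ∂μ ∂μ)
              - ∫ a, ∫ b, min (p a * q' b) (p b * q' a) ∂μ ∂μ|}
      ≤ P.real ({ω | N ω + s.card * t ≤ s.card * ∫ y in E, q y ∂μ}
          ∪ {ω | N' ω + s'.card * t' ≤ s'.card * ∫ y in E, q' y ∂μ}) := measureReal_mono hsub
    _ ≤ P.real {ω | N ω + s.card * t ≤ s.card * ∫ y in E, q y ∂μ}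
          + P.real {ω | N' ω + s'.card * t' ≤ s'.card * ∫ y in E, q' y ∂μ} :=
        measureReal_union_le _ _
    _ ≤ Real.exp (-(2 * s.card * t ^ 2)) + Real.exp (-(2 * s'.card * t' ^ 2)) := add_le_add hA hA'

/-- **The same at prescribed confidence levels.**  With the Hoeffding radii
`t = √(log(1/η)/(2n))`, `t' = √(log(1/η')/(2n'))` (`0 < η, η' ≤ 1`):
`P( (e^{δ} − 1) + (N/n + t) + (N'/n' + t') < |acc(p,q) − acc(p,q')| ) ≤ η + η'`. -/
theorem acceptance_parityLeg_confidence_level [SFinite μ] {p q q' : X → ℝ} (hp0 : ∀ y, 0 ≤ p y)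
    (hpm : Measurable p) (hpi : Integrable p μ) (hp1 : ∫ y, p y ∂μ = 1) (hq0 : ∀ y, 0 < q y)
    (hqm : Measurable q) (hqi : Integrable q μ) (hq1 : ∫ y, q y ∂μ = 1) (hq0' : ∀ y, 0 < q' y)
    (hqm' : Measurable q') (hqi' : Integrable q' μ) (hq1' : ∫ y, q' y ∂μ = 1) {E : Set X}
    (hE : MeasurableSet E) {δ : ℝ} (hδ : 0 ≤ δ)
    (hlog : ∀ y, y ∉ E → |Real.log (q y) - Real.log (q' y)| ≤ δ)
    {x : ι → Ω → X} (hind : iIndepFun x P) (hxm : ∀ i, Measurable (x i))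
    (hlaw : ∀ i, Measure.map (x i) P = μ.withDensity fun y => ENNReal.ofReal (q y))
    {ι' : Type*} {x' : ι' → Ω → X} (hind' : iIndepFun x' P) (hxm' : ∀ j, Measurable (x' j))
    (hlaw' : ∀ j, Measure.map (x' j) P = μ.withDensity fun y => ENNReal.ofReal (q' y))
    (s : Finset ι) (s' : Finset ι') (hs : 0 < s.card) (hs' : 0 < s'.card) {η η' : ℝ}
    (hη : 0 < η) (hη1 : η ≤ 1) (hη' : 0 < η') (hη1' : η' ≤ 1) :
    P.real {ω | (Real.exp δ - 1)
          + ((∑ i ∈ s, E.indicator (fun _ => (1 : ℝ)) (x i ω)) / s.card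
              + Real.sqrt (Real.log (1 / η) / (2 * s.card)))
          + ((∑ j ∈ s', E.indicator (fun _ => (1 : ℝ)) (x' j ω)) / s'.card
              + Real.sqrt (Real.log (1 / η') / (2 * s'.card)))
        < |(∫ a, ∫ b, min (p a * q b) (p b * q a) ∂μ ∂μ)
            - ∫ a, ∫ b, min (p a * q' b) (p b * q' a) ∂μ ∂μ|}
      ≤ η + η' := by
  have hn : (0 : ℝ) < s.card := by exact_mod_cast hs
  have hn' : (0 : ℝ) < s'.card := by exact_mod_cast hs'
  -- `exp(−2n·(√(log(1/η)/(2n)))²) = exp(−log(1/η)) = η`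
  have hrad : ∀ {n θ : ℝ}, 0 < n → 0 < θ → θ ≤ 1 →
      Real.exp (-(2 * n * Real.sqrt (Real.log (1 / θ) / (2 * n)) ^ 2)) = θ := by
    intro n θ hn hθ hθ1
    have hL : 0 ≤ Real.log (1 / θ) := Real.log_nonneg (by rw [le_div_iff₀ hθ, one_mul]; exact hθ1)
    rw [Real.sq_sqrt (div_nonneg hL (by positivity)), mul_div_cancel₀ _ (by positivity),
      Real.exp_neg, Real.exp_log (by positivity), one_div, inv_inv]
  have h := acceptance_parityLeg_confidence hp0 hpm hpi hp1 hq0 hqm hqi hq1 hq0' hqm' hqi' hq1' hE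
    hδ hlog hind hxm hlaw hind' hxm' hlaw' s s' hs hs' (Real.sqrt_nonneg _) (Real.sqrt_nonneg _)
    (t := Real.sqrt (Real.log (1 / η) / (2 * s.card)))
    (t' := Real.sqrt (Real.log (1 / η') / (2 * s'.card)))
  rw [hrad hn hη hη1, hrad hn' hη' hη1'] at h
  exact h

end Summit.Ventures.LatticeQCDFlow.Scoring.ParityLeg

end
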